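import Mathlib

/-!
# `Balaban1983to89.B8Ineq125` — the Cauchy-estimate step (1.124) ⇒ (1.125) of B8 Sect. E, in the WEIGHTED norm

CITATION HEADER (lean-in-tree rule 2026-08-18). Reproduction of one displayed step of T. Bałaban, *Spaces of
regular gauge field configurations on a lattice and gauge fixing conditions*, Comm. Math. Phys. **99**, 75–102
(1985) [Balaban1985RegularSpaces] (cell paper B8; `paper:balaban1985-cmp99-regular-spaces-gauge-fixing`, journal
page = PDF page + 74), p. 97 [PDF 23], render-checked 2026-08-18.  The paper is UNDER ADJUDICATION by the audit
cell `pub-balaban`; nothing of it is asserted here.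

WHAT IS PRINTED (p. 97): "(1.124) ⟨δC′(λ)/δλ, λ₀⟩ = (2πi)⁻¹ ∮_{|τ|=r} dτ τ⁻² C′(λ+τλ₀).  Taking
r = (2 max{|λ₀|, |Dλ₀|})⁻¹ α₄, we get the estimate (1.125) |⟨δC′(λ)/δλ, λ₀⟩| ≤ C′₂ 2 max{|λ₀|, |Dλ₀|} (α₃+α₄).
Applying it to the expression (1.122) we have |C′(λ−H′X₁) − C′(λ−H′X₂)| ≤ C′₂ 2B′₀(α₃+α₄)|X₁−X₂|".
The domain of C′ on which the bound (1.121) |C′(·)| < C′₂(α₃+α₄)α₄ is available is (1.120):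
|λ| < α₄, |Dλ| < α₄(L^jη)⁻¹ on Ω_j; the map H′ satisfies ((1.119) ⇒ (1.120)) |H′X| ≤ B′₀|X| AND
|D H′X| ≤ B′₀(L^jη)⁻¹|X| on Ω_j.

OBSERVATION (GAPS row of unit b2b-balaban-adv1, gen 2): with the UNWEIGHTED max{|λ₀|, |Dλ₀|} printed in
(1.125), the application to (1.122) (λ₀ = H′(X₁−X₂)) gives the factor max{|H′(X₁−X₂)|, |DH′(X₁−X₂)|}
≤ B′₀(L^jη)⁻¹|X₁−X₂| — the contraction constant would carry (L^jη)⁻¹ and is NOT small.  The displayed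
conclusion needs the WEIGHTED modulus m(λ₀) := max{|λ₀|, L^jη|Dλ₀|} (sup over Ω_j, j = 0..k) in (1.125), for
which m(H′X) ≤ B′₀|X| by (1.120).  The weighted (1.125) holds by the SAME Cauchy estimate (1.124) with
r = α₄/(2 m(λ₀)): this file proves (i) that this radius keeps λ+τλ₀ inside (1.120) whenever λ lies in the
half-size set (1.119) (`radius_keeps_domain`), and (ii) the Cauchy bound ‖d/dτ C′(λ+τλ₀)|₀‖ ≤ 2 m(λ₀)·M/α₄
from ‖C′‖ ≤ M on the circle (`cauchy_weighted`), and (iii) the arithmetic with M = C′₂(α₃+α₄)α₄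
(`ineq125_weighted`).  So the printed (1.125) is a MISPRINT (missing weight L^jη on the D-component, i.e. the
"on Ω_j" scale convention of (1.119)–(1.120) dropped), repaired without new input.  Together with
`B8SectE.fixedPoint_lipschitz` / `onto_of_lipschitz_half` (norm ‖λ‖ := m(λ)) this closes the |Dλ|-component
of the "onto" sentence of p. 97 (GAPS G-B8-05 / C-A3-1) modulo the printed (1.120), (1.121) and (1.92).

v1.1 (lit-balaban r05, 2026-08-20): locator tags `[cite: Balaban1985RegularSpaces, …]` added to the four
declaration docstrings (SKELETON row B8.Eq1.125; MISSING-SOURCES §C.2); no declaration, statement or proof changed.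
Framing of the lit-balaban skeleton these tags serve:
statement-level skeleton of published theorems with citation tags; proofs where landed; nothing here is a claim
about the Yang–Mills mass gap.
-/

noncomputable section

namespace Literature.MathematicalPhysics.QuantumFieldTheory.Balaban1983to89.B8Ineq125

open Metric Set

variable {E : Type*} [NormedAddCommGroup E] [NormedSpace ℂ E]

/-- (i) Radius choice of p. 97, weighted form.  `p`, `q` stand for the two seminorms `λ ↦ sup_{Ω_j}|λ|` and
`λ ↦ sup_{Ω_j} L^jη|Dλ|` (the weighted D-component); `m := max (p λ₀) (q λ₀)`.  If `λ` is in the half-size set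
(1.119) (`p λ < α/2`, `q λ < α/2`) and `0 < m`, then for every `τ` with `‖τ‖ ≤ α/(2m)` the point `λ + τ•λ₀` lies in
the set (1.120) (`p < α`, `q < α`).  Elementary seminorm arithmetic for the radius choice
«r = (2max{|λ₀|, |Dλ₀|})⁻¹α₄» printed after (1.124). [cite: Balaban1985RegularSpaces, (1.124)–(1.125) p.97;
domains (1.119)–(1.120) p.96] -/
theorem radius_keeps_domain (p q : Seminorm ℂ E) {α : ℝ} (lam lam₀ : E)
    (hp : p lam < α / 2) (hq : q lam < α / 2)
    (hm : 0 < max (p lam₀) (q lam₀)) (τ : ℂ) (hτ : ‖τ‖ ≤ α / (2 * max (p lam₀) (q lam₀))) :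
    p (lam + τ • lam₀) < α ∧ q (lam + τ • lam₀) < α := by
  set m := max (p lam₀) (q lam₀) with hmdef
  have hα : 0 < α := by
    have := apply_nonneg p lam; linarith
  have hτm : ‖τ‖ * m ≤ α / 2 := by
    calc ‖τ‖ * m ≤ α / (2 * m) * m := mul_le_mul_of_nonneg_right hτ hm.le
      _ = α / 2 := by field_simp
  constructor
  · calc p (lam + τ • lam₀) ≤ p lam + p (τ • lam₀) := map_add_le_add p _ _
      _ = p lam + ‖τ‖ * p lam₀ := by rw [map_smul_eq_mul]
      _ ≤ p lam + ‖τ‖ * m := by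
          have := mul_le_mul_of_nonneg_left (le_max_left (p lam₀) (q lam₀)) (norm_nonneg τ); linarith
      _ < α := by linarith
  · calc q (lam + τ • lam₀) ≤ q lam + q (τ • lam₀) := map_add_le_add q _ _
      _ = q lam + ‖τ‖ * q lam₀ := by rw [map_smul_eq_mul]
      _ ≤ q lam + ‖τ‖ * m := by
          have := mul_le_mul_of_nonneg_left (le_max_right (p lam₀) (q lam₀)) (norm_nonneg τ); linarith
      _ < α := by linarith

variable {F : Type*} [NormedAddCommGroup F] [NormedSpace ℂ F]

/-- (ii) The Cauchy estimate (1.124) ⇒ (1.125), weighted: if `f τ := C′(λ + τλ₀)` is complex-differentiable on the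
disc of radius `r = α/(2m)` (`m > 0`), continuous on its closure, and `‖f‖ ≤ M` on the circle, then
`‖deriv f 0‖ ≤ 2 m M / α`. (Mathlib: `Complex.norm_deriv_le_of_forall_mem_sphere_norm_le`; the Cauchy formula
(1.124) is the printed source of the estimate.) [cite: Balaban1985RegularSpaces, (1.124) p.97] -/
theorem cauchy_weighted {f : ℂ → F} {m α M : ℝ} (hm : 0 < m) (hα : 0 < α)
    (hd : DiffContOnCl ℂ f (ball (0 : ℂ) (α / (2 * m))))
    (hM : ∀ z ∈ sphere (0 : ℂ) (α / (2 * m)), ‖f z‖ ≤ M) :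
    ‖deriv f 0‖ ≤ 2 * m * M / α := by
  have hr : 0 < α / (2 * m) := by positivity
  have := Complex.norm_deriv_le_of_forall_mem_sphere_norm_le hr hd hM
  calc ‖deriv f 0‖ ≤ M / (α / (2 * m)) := this
    _ = 2 * m * M / α := by field_simp

/-- (iii) The printed constants: with `M = C′₂(α₃+α₄)α₄` the bound (ii) is exactly
`2 m C′₂ (α₃+α₄)` — (1.125) with the weighted modulus `m = max{|λ₀|, L^jη|Dλ₀|}` (the printed (1.125) has the
unweighted `max{|λ₀|, |Dλ₀|}`; see the module header). [cite: Balaban1985RegularSpaces, (1.125) p.97; input bound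
(1.121) p.96] -/
theorem ineq125_weighted {f : ℂ → F} {m α₃ α₄ C₂ : ℝ} (hm : 0 < m) (hα : 0 < α₄)
    (hd : DiffContOnCl ℂ f (ball (0 : ℂ) (α₄ / (2 * m))))
    (hM : ∀ z ∈ sphere (0 : ℂ) (α₄ / (2 * m)), ‖f z‖ ≤ C₂ * (α₃ + α₄) * α₄) :
    ‖deriv f 0‖ ≤ C₂ * 2 * m * (α₃ + α₄) := by
  have := cauchy_weighted hm hα hd hM
  calc ‖deriv f 0‖ ≤ 2 * m * (C₂ * (α₃ + α₄) * α₄) / α₄ := this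
    _ = C₂ * 2 * m * (α₃ + α₄) := by field_simp

/-- The loss in the UNWEIGHTED reading: if only `|D H′X| ≤ B (L^jη)⁻¹ |X|` is available (as printed in (1.120)),
the unweighted modulus of `H′X` is bounded by `B·(L^jη)⁻¹·|X|`, which for `L^jη ≤ 1` is ≥ `B|X|` and tends to
`∞` as `L^jη → 0`: the printed (1.125) cannot feed the displayed bound after (1.125) without the weight.  (Pure
arithmetic; recorded so the objection is checkable — it concerns the printed, unweighted form of (1.125).)
[cite: Balaban1985RegularSpaces, (1.125) p.97; (1.120) p.96] -/
theorem unweighted_loss {B x s : ℝ} (hB : 0 ≤ B) (hx : 0 ≤ x) (hs : 0 < s) (hs1 : s ≤ 1) :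
    B * x ≤ max (B * x) (B * s⁻¹ * x) ∧ B * x ≤ B * s⁻¹ * x := by
  have h1 : 1 ≤ s⁻¹ := one_le_inv_iff₀.mpr ⟨hs, hs1⟩
  have : B * x ≤ B * s⁻¹ * x := by
    have := mul_le_mul_of_nonneg_left h1 hB
    nlinarith [mul_le_mul_of_nonneg_right this hx]
  exact ⟨le_max_left _ _, this⟩

end Literature.MathematicalPhysics.QuantumFieldTheory.Balaban1983to89.B8Ineq125
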